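import Mathlib
import Summits.Ventures.PercRepro.TriangleCapThreeBelowSecondBest

/-!
# PercRepro — BROOMS AND `4`-CYCLES: the two shapes of the equality case of the non-star bound, and three small
incidence lemmas (p3, gen 45; part 204a)

`IsBroom H`: the edges at `v₀` together with one edge `x y` hung at the leaf `x` (`x ∼ v₀`, `y ≁ v₀`); `IsC4 H`: the
`4`-cycle `v₀ x₁ y x₂` and nothing else. `edge_of_mem`: an edge containing `x` is `s(x, w)`; `exists_other_edge`:
a vertex of degree `2` has a second edge; `edge_unique_of_deg_one`: a vertex of degree `1` has one edge.
Axioms: standard.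
-/

namespace PercRepro

namespace TriangleCap

namespace C047

open Finset

variable {V : Type*} [Fintype V] [DecidableEq V]

/-- A broom: the edges at `v₀` together with one edge `x y` hung at the leaf `x`. -/
def IsBroom (H : SimpleGraph V) [DecidableRel H.Adj] : Prop :=
  ∃ v₀ x y : V, H.Adj v₀ x ∧ H.Adj x y ∧ y ≠ v₀ ∧ ¬ H.Adj v₀ y ∧ ∀ e ∈ H.edgeFinset, v₀ ∈ e ∨ e = s(x, y)

/-- A `4`-cycle `v₀ x₁ y x₂`: the four edges and nothing else. -/
def IsC4 (H : SimpleGraph V) [DecidableRel H.Adj] : Prop :=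
  ∃ v₀ x₁ x₂ y : V, H.Adj v₀ x₁ ∧ H.Adj v₀ x₂ ∧ H.Adj x₁ y ∧ H.Adj x₂ y ∧ x₁ ≠ x₂ ∧ v₀ ≠ y ∧
    ∀ e ∈ H.edgeFinset, e = s(v₀, x₁) ∨ e = s(v₀, x₂) ∨ e = s(x₁, y) ∨ e = s(x₂, y)

/-- The incidence finset of `x` has `deg H x` elements. -/
theorem card_incidence_eq_deg (H : SimpleGraph V) [DecidableRel H.Adj] (x : V) :
    (H.incidenceFinset x).card = deg H x := by
  rw [deg_eq_card_incidenceFinset]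

omit [DecidableEq V] in
/-- An edge containing `x` is `s(x, w)` for the other end `w`, adjacent to `x`. -/
theorem edge_of_mem (H : SimpleGraph V) [DecidableRel H.Adj] {x : V} {e : Sym2 V} (he : e ∈ H.edgeFinset)
    (hx : x ∈ e) : ∃ w, e = s(x, w) ∧ H.Adj x w := by
  revert he hx
  refine Sym2.ind (fun a b he hx => ?_) e
  rw [SimpleGraph.mem_edgeFinset, SimpleGraph.mem_edgeSet] at he
  rw [Sym2.mem_iff] at hx
  rcases hx with rfl | rfl
  · exact ⟨b, rfl, he⟩
  · exact ⟨a, Sym2.eq_swap, he.symm⟩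

/-- A vertex of degree `2` whose incidence set contains `e₁` has another edge `e₂ ≠ e₁`. -/
theorem exists_other_edge (H : SimpleGraph V) [DecidableRel H.Adj] {x : V} (hx : deg H x = 2) {e₁ : Sym2 V}
    (he₁ : e₁ ∈ H.edgeFinset) (hx₁ : x ∈ e₁) : ∃ e₂ ∈ H.edgeFinset, x ∈ e₂ ∧ e₂ ≠ e₁ := by
  have hmem : e₁ ∈ H.incidenceFinset x := by
    rw [SimpleGraph.mem_incidenceFinset]
    exact ⟨(SimpleGraph.mem_edgeFinset).mp he₁, hx₁⟩
  have hc := card_incidence_eq_deg H x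
  rw [hx] at hc
  have h2 : 1 ≤ ((H.incidenceFinset x).erase e₁).card := by
    rw [card_erase_of_mem hmem, hc]
  obtain ⟨e₂, he₂⟩ := card_pos.mp h2
  rw [mem_erase, SimpleGraph.mem_incidenceFinset] at he₂
  exact ⟨e₂, (SimpleGraph.mem_edgeFinset).mpr he₂.2.1, he₂.2.2, he₂.1⟩

/-- A vertex of degree `1` has only one edge: a second edge containing it is the same. -/
theorem edge_unique_of_deg_one (H : SimpleGraph V) [DecidableRel H.Adj] {x : V} (hx : deg H x = 1)
    {e₁ e₂ : Sym2 V} (he₁ : e₁ ∈ H.edgeFinset) (hx₁ : x ∈ e₁) (he₂ : e₂ ∈ H.edgeFinset) (hx₂ : x ∈ e₂) :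
    e₁ = e₂ := by
  have hm1 : e₁ ∈ H.incidenceFinset x := by
    rw [SimpleGraph.mem_incidenceFinset]; exact ⟨(SimpleGraph.mem_edgeFinset).mp he₁, hx₁⟩
  have hm2 : e₂ ∈ H.incidenceFinset x := by
    rw [SimpleGraph.mem_incidenceFinset]; exact ⟨(SimpleGraph.mem_edgeFinset).mp he₂, hx₂⟩
  have hc := card_incidence_eq_deg H x
  rw [hx] at hc
  exact (card_le_one.mp (le_of_eq hc)) e₁ hm1 e₂ hm2

end C047

end TriangleCap

end PercRepro
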